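import Mathlib.RingTheory.Etale.Kaehler
import Mathlib.RingTheory.Finiteness.Nakayama
import Mathlib.RingTheory.OrzechProperty
import Mathlib.RingTheory.Smooth.StandardSmoothCotangent
import Literature.AlgebraicGeometry.RealAlgebraic.RealPointsDifferentials
import Literature.AlgebraicGeometry.Motives.UniversalHyperplaneSectionChart
import Literature.RingTheory.KrullDimension.TangentDimension
import HarnessLib

/-!
# Algebraic and analytic differentials of regular functions at real points

Let `X` be an `ℝ`-scheme smooth of relative dimension `n`, `Q₀ ∈ X(ℝ)` a real point and
`t₁, …, tₙ ∈ Γ(X, U)` local coordinates at `Q₀` (spanning `𝔪_{Q₀}` modulo `𝔪_{Q₀}²`;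
`RealPoints.exists_localCoordinates_le`). This file compares the module of Kähler differentials
`Ω_{Γ(X,U')/ℝ}` near `Q₀` with the analytic differentials of regular functions read in an analytic
algebraic chart (`RealAlgebraic/RealPointsDifferentials`):

* `top_le_span_D_sup`, `exists_smul_mem_span_D`, `top_le_span_D_of_isLocalization`,
  `exists_basis_of_span_D` — the commutative algebra: if `t` spans `𝔪` modulo `𝔪²` at a rational
  maximal ideal `𝔪` then `Ω = ∑ A dtᵢ + 𝔪Ω`, so (Nakayama) `r Ω ⊆ ∑ A dtᵢ` for some
  `r ≡ 1 mod 𝔪`, the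
  `dtᵢ` generate `Ω_{A_r}`, and `n` generators of a free module of rank `n` are a basis
  (Vasconcelos / Orzech: a surjective endomorphism of a finite module is injective);
* `exists_affineOpen_basis_kaehler` — hence **`dt₁, …, dtₙ` is a basis of `Ω_{Γ(X,U')/ℝ}` on an
  affine neighbourhood `U' ⊆ U` of `Q₀`** (EGA IV₄ 17.15.5 / Görtz–Wedhorn I 6.26 with Stacks
  00TV in
  the form "a system of local coordinates at a smooth rational point gives a local frame of `Ω`");
* `fderivPointDerivation`, `fderiv_chart_eq_sum_eval_coord` — the differential at a real point
  `Q ∈ U'(ℝ)` of a regular function read in an analytic algebraic chart is an `ℝ`-derivation of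
  `Γ(X, U')` into `ℝ_Q` (the tree's `Literature.PointModule`), hence factors through `Ω`: **the
  analytic
  partial derivatives are the values at `Q` of the algebraic ones**,
  `d(a ∘ φ⁻¹)(φ Q) = ∑ⱼ (∂a/∂tⱼ)(Q) · d(tⱼ ∘ φ⁻¹)(φ Q)` with `∂a/∂tⱼ ∈ Γ(X, U')` the coordinates of
  `da` in the basis `(dtⱼ)` (Serre, GAGA §2 n°6: the completions of the algebraic and analytic local
  rings agree, in its first-order consequence; Bochnak–Coste–Roy §3.3–3.4 for real points);
* `exists_sections_of_span_germ_eq_maximalIdeal`, `htspan_of_le`, `ker_evalRingHom_eq_primeIdealOf`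
  — bookkeeping between germs at `Q₀.pt` and sections: a system of parameters of the local ring
  `𝒪_{X,Q₀}` is represented on small affine neighbourhoods by local coordinates in the above sense,
  and the local-coordinate property passes to smaller affine neighbourhoods.

Everything is proved; no named facts.

## References

* J.-P. Serre, *Géométrie algébrique et géométrie analytique*, Ann. Inst. Fourier 6 (1956), §2 n°6
  Prop. 3 and Cor. 1–2. [SerreGAGA1956]
* J. Bochnak, M. Coste, M.-F. Roy, *Real Algebraic Geometry* (1998), §3.3 (Prop. 3.3.11), §3.4.
  [BochnakCosteRoy1998]
* U. Görtz, T. Wedhorn, *Algebraic Geometry I* (2nd ed. 2020), Lemma 6.26, Thm. 6.28.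
  [GortzWedhorn2020]
* The Stacks Project, Tags 00TV, 00DV (Nakayama), 05G3 (Vasconcelos). [StacksProject]
-/

noncomputable section

open scoped Manifold ContDiff Topology
open CategoryTheory AlgebraicGeometry Filter Set KaehlerDifferential
open Literature.AlgebraicGeometry.Motives
open Literature.AlgebraicGeometry.Motives.AlgPoints (evalOrZero evalOrZero_of_mem
  evalOrZero_of_not_mem)
open Literature.RingTheory.KrullDimension (PointModule)

namespace Literature.AlgebraicGeometry.RealAlgebraic

namespace RealPoints

/-! ### Commutative algebra: local coordinates give a local frame of `Ω` -/

section Algebra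

variable {K : Type*} [Field K] {A : Type*} [CommRing A] [Algebra K A]

/-- If `t₁, …, tₘ` span the `K`-rational maximal ideal `𝔪 = ker ψ` modulo `𝔪²`, then
`Ω_{A/K} = ∑ᵢ A dtᵢ + 𝔪 Ω_{A/K}`: for `a ∈ A`, `da = d(a - ψ(a)) = ∑ cᵢ dtᵢ + dy` with `y ∈ 𝔪²`, and
`d(𝔪²) ⊆ 𝔪Ω`. [folklore] -/
theorem top_le_span_D_sup (𝔪 : Ideal A) (ψ : A →ₐ[K] K) (hψ : ∀ a, ψ a = 0 ↔ a ∈ 𝔪)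
    {ι : Type*} [Fintype ι] (t : ι → A)
    (htspan : ∀ a ∈ 𝔪, ∃ coef : ι → K, a - ∑ i, coef i • t i ∈ 𝔪 ^ 2) :
    (⊤ : Submodule A Ω[A⁄K]) ≤
      Submodule.span A (Set.range fun i => D K A (t i)) ⊔ 𝔪 • ⊤ := by
  classical
  suffices h : Submodule.span A (Set.range (D K A)) ≤
      Submodule.span A (Set.range fun i => D K A (t i)) ⊔ 𝔪 • ⊤ by
    rwa [KaehlerDifferential.span_range_derivation] at h
  rw [Submodule.span_le]
  rintro _ ⟨a, rfl⟩
  set x := a - algebraMap K A (ψ a) with hx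
  have hx𝔪 : x ∈ 𝔪 := (hψ x).1 (by simp [hx])
  have hDa : D K A a = D K A x := by
    simp only [hx, map_sub, Derivation.map_algebraMap, sub_zero]
  obtain ⟨coef, hcoef⟩ := htspan x hx𝔪
  set y := x - ∑ i, coef i • t i with hy
  have hDx : D K A x = ∑ i, coef i • D K A (t i) + D K A y := by
    simp only [hy, map_sub, map_sum, Derivation.map_smul_of_tower]
    abel
  have hsq : ∀ z ∈ 𝔪 ^ 2, D K A z ∈ 𝔪 • (⊤ : Submodule A Ω[A⁄K]) := by
    intro z hz
    rw [pow_two] at hz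
    refine Submodule.mul_induction_on hz (fun b hb c hc => ?_) (fun b c hb hc => ?_)
    · rw [Derivation.leibniz]
      exact Submodule.add_mem _ (Submodule.smul_mem_smul hb Submodule.mem_top)
        (Submodule.smul_mem_smul hc Submodule.mem_top)
    · rw [map_add]; exact Submodule.add_mem _ hb hc
  rw [SetLike.mem_coe, hDa, hDx]
  refine Submodule.add_mem _ (Submodule.mem_sup_left (Submodule.sum_mem _ fun i _ => ?_))
    (Submodule.mem_sup_right (hsq y hcoef))
  rw [← algebraMap_smul A (coef i)]
  exact Submodule.smul_mem _ _ (Submodule.subset_span ⟨i, rfl⟩)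

/-- **Nakayama**: under the hypotheses of `top_le_span_D_sup` and if `Ω_{A/K}` is finitely
generated, there is `r ≡ 1 (mod 𝔪)` with `r Ω_{A/K} ⊆ ∑ᵢ A dtᵢ`. [cite: StacksProject, Tag 00DV] -/
theorem exists_smul_mem_span_D [Module.Finite A Ω[A⁄K]] (𝔪 : Ideal A) (ψ : A →ₐ[K] K)
    (hψ : ∀ a, ψ a = 0 ↔ a ∈ 𝔪) {ι : Type*} [Fintype ι] (t : ι → A)
    (htspan : ∀ a ∈ 𝔪, ∃ coef : ι → K, a - ∑ i, coef i • t i ∈ 𝔪 ^ 2) :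
    ∃ r : A, r - 1 ∈ 𝔪 ∧
      ∀ w : Ω[A⁄K], r • w ∈ Submodule.span A (Set.range fun i => D K A (t i)) := by
  set N := Submodule.span A (Set.range fun i => D K A (t i)) with hN
  have htop : (⊤ : Submodule A (Ω[A⁄K] ⧸ N)) ≤ 𝔪 • ⊤ := by
    rintro q -
    obtain ⟨w, rfl⟩ := N.mkQ_surjective q
    have hw := top_le_span_D_sup 𝔪 ψ hψ t htspan (Submodule.mem_top (x := w))
    have : N.mkQ w ∈ Submodule.map N.mkQ (N ⊔ 𝔪 • ⊤) := Submodule.mem_map_of_mem hw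
    rwa [Submodule.map_sup, Submodule.mkQ_map_self, bot_sup_eq, Submodule.map_smul'',
      Submodule.map_top, Submodule.range_mkQ] at this
  obtain ⟨r, hr1, hr⟩ := Submodule.exists_sub_one_mem_and_smul_eq_zero_of_fg_of_le_smul 𝔪
    (⊤ : Submodule A (Ω[A⁄K] ⧸ N)) Module.Finite.fg_top htop
  refine ⟨r, hr1, fun w => ?_⟩
  have h := hr (N.mkQ w) Submodule.mem_top
  rw [← map_smul, Submodule.mkQ_apply, Submodule.Quotient.mk_eq_zero] at h
  exact h

/-- If `r Ω_{A/K} ⊆ ∑ᵢ A dtᵢ` then the `dtᵢ` generate `Ω_{B/K}` for `B = A[1/r]` (Kähler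
differentials commute with localisation, Mathlib `KaehlerDifferential.isLocalizedModule_map`).
[folklore] -/
theorem top_le_span_D_of_isLocalization {B : Type*} [CommRing B] [Algebra K B] [Algebra A B]
    [IsScalarTower K A B] (r : A) [IsLocalization.Away r B] {ι : Type*} (t : ι → A)
    (hr : ∀ w : Ω[A⁄K], r • w ∈ Submodule.span A (Set.range fun i => D K A (t i))) :
    (⊤ : Submodule B Ω[B⁄K]) ≤
      Submodule.span B (Set.range fun i => D K B (algebraMap A B (t i))) := by
  rintro y -
  obtain ⟨⟨w, s⟩, hs⟩ := IsLocalizedModule.surj (Submonoid.powers r) (map K K A B) y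
  -- `(r s) • y = map (r • w)` lies in the span
  have hmem : map K K A B (r • w) ∈
      Submodule.span B (Set.range fun i => D K B (algebraMap A B (t i))) := by
    have h1 : map K K A B (r • w) ∈ Submodule.map ((map K K A B).restrictScalars A)
        (Submodule.span A (Set.range fun i => D K A (t i))) :=
      Submodule.mem_map_of_mem (hr w)
    rw [Submodule.map_span] at h1
    refine Submodule.span_le.2 ?_ (Submodule.span_subset_span A B _ h1)
    rintro _ ⟨_, ⟨i, rfl⟩, rfl⟩
    refine Submodule.subset_span ⟨i, ?_⟩
    simp only [LinearMap.coe_restrictScalars, map_D]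
  have hunit : IsUnit (algebraMap A B (r * s)) :=
    IsLocalization.map_units B ⟨r * s, Submonoid.mul_mem _ (Submonoid.mem_powers r) s.2⟩
  have hy : algebraMap A B (r * s) • y = map K K A B (r • w) := by
    rw [map_mul, mul_smul, algebraMap_smul, algebraMap_smul]
    change r • ((s : A) • y) = _
    rw [show (s : A) • y = s • y from rfl, hs, LinearMap.map_smul_of_tower]
  rw [← hunit.unit_spec] at hy
  have : y = hunit.unit⁻¹ • (map K K A B (r • w)) := by
    rw [← hy]
    exact (inv_smul_smul hunit.unit y).symm
  rw [this, Units.smul_def]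
  exact Submodule.smul_mem _ _ hmem

end Algebra

/-! ### Germs and values at a real point -/

section Germs

variable {X : SchemeOver ℝ}

/-- `s(Q) = 0` iff the germ of `s` at `Q.pt` lies in the maximal ideal of `𝒪_{X,Q.pt}`.
[folklore] -/
theorem eval_eq_zero_iff_germ_mem_maximalIdeal (Q : AlgPoints X ℝ) {U : X.left.Opens}
    (hQU : Q.pt ∈ U) (s : Γ(X.left, U)) :
    Q.eval U hQU s = 0 ↔
      (X.left.presheaf.germ U Q.pt hQU).hom s ∈
        IsLocalRing.maximalIdeal (X.left.presheaf.stalk Q.pt) := by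
  rw [IsLocalRing.mem_maximalIdeal, mem_nonunits_iff, ← Scheme.mem_basicOpen,
    AlgPoints.pt_mem_basicOpen_iff Q hQU, not_not]

/-- On an affine open `U ∋ Q.pt`, the kernel of evaluation at the real point `Q` is the prime
ideal of `Γ(X, U)` corresponding to the point `Q.pt`. [folklore] -/
theorem ker_evalRingHom_eq_primeIdealOf (Q : AlgPoints X ℝ) (U : X.left.affineOpens)
    (hQU : Q.pt ∈ (↑U : X.left.Opens)) :
    RingHom.ker (Q.evalRingHom ↑U hQU) = (U.2.primeIdealOf ⟨Q.pt, hQU⟩).asIdeal := by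
  letI alg : Algebra Γ(X.left, ↑U) (X.left.presheaf.stalk Q.pt) :=
    (X.left.presheaf.germ ↑U Q.pt hQU).hom.toAlgebra
  haveI : IsLocalization.AtPrime (X.left.presheaf.stalk Q.pt)
      (U.2.primeIdealOf ⟨Q.pt, hQU⟩).asIdeal :=
    U.2.isLocalization_stalk ⟨Q.pt, hQU⟩
  ext a
  rw [RingHom.mem_ker, AlgPoints.evalRingHom_apply, eval_eq_zero_iff_germ_mem_maximalIdeal,
    ← IsLocalization.AtPrime.to_map_mem_maximal_iff (X.left.presheaf.stalk Q.pt)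
      (U.2.primeIdealOf ⟨Q.pt, hQU⟩).asIdeal a]
  rfl

/-- The maximal ideal of `𝒪_{X,Q}` is the extension of the prime of `Q.pt` in `Γ(X, U)`, `U`
affine (for the germ map, a localisation at that prime). [folklore] -/
theorem maximalIdeal_eq_map_primeIdealOf {x : X.left} (U : X.left.affineOpens)
    (hxU : x ∈ (↑U : X.left.Opens)) :
    IsLocalRing.maximalIdeal (X.left.presheaf.stalk x) =
      Ideal.map (X.left.presheaf.germ ↑U x hxU).hom (U.2.primeIdealOf ⟨x, hxU⟩).asIdeal := by
  letI alg : Algebra Γ(X.left, ↑U) (X.left.presheaf.stalk x) :=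
    (X.left.presheaf.germ ↑U x hxU).hom.toAlgebra
  haveI : IsLocalization.AtPrime (X.left.presheaf.stalk x) (U.2.primeIdealOf ⟨x, hxU⟩).asIdeal :=
    U.2.isLocalization_stalk ⟨x, hxU⟩
  exact (IsLocalization.AtPrime.map_eq_maximalIdeal (U.2.primeIdealOf ⟨x, hxU⟩).asIdeal
    (X.left.presheaf.stalk x)).symm

/-- A stalk element in the maximal ideal is congruent, modulo `𝔪_Q²`, to an `ℝ`-combination of
the germs of local coordinates `t` (affine `U ∋ Q`, `t` spanning `ker (eval at Q)` modulo its
square). [folklore] -/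
theorem exists_sub_sum_germ_mem_sq (Q : AlgPoints X ℝ) (U : X.left.affineOpens)
    (hQU : Q.pt ∈ (↑U : X.left.Opens)) {m : ℕ} (t : Fin m → Γ(X.left, ↑U))
    (htspan : ∀ a ∈ RingHom.ker (Q.evalRingHom ↑U hQU), ∃ coef : Fin m → ℝ,
      a - ∑ i, SchemeOver.scalarRingHom X ↑U (coef i) * t i ∈
        RingHom.ker (Q.evalRingHom ↑U hQU) ^ 2)
    {x : X.left.presheaf.stalk Q.pt} (hx : x ∈ IsLocalRing.maximalIdeal _) :
    ∃ coef : Fin m → ℝ,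
      x - ∑ i, (X.left.presheaf.germ ↑U Q.pt hQU).hom
        (SchemeOver.scalarRingHom X ↑U (coef i) * t i) ∈
        IsLocalRing.maximalIdeal (X.left.presheaf.stalk Q.pt) ^ 2 := by
  classical
  letI alg : Algebra Γ(X.left, ↑U) (X.left.presheaf.stalk Q.pt) :=
    (X.left.presheaf.germ ↑U Q.pt hQU).hom.toAlgebra
  set 𝔭 := (U.2.primeIdealOf ⟨Q.pt, hQU⟩).asIdeal with h𝔭
  haveI : IsLocalization.AtPrime (X.left.presheaf.stalk Q.pt) 𝔭 :=
    U.2.isLocalization_stalk ⟨Q.pt, hQU⟩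
  have hger : ∀ a : Γ(X.left, ↑U), algebraMap Γ(X.left, ↑U) (X.left.presheaf.stalk Q.pt) a =
      (X.left.presheaf.germ ↑U Q.pt hQU).hom a := fun a => rfl
  have hker := ker_evalRingHom_eq_primeIdealOf Q U hQU
  have hm := maximalIdeal_eq_map_primeIdealOf U hQU
  -- `x = germ a / germ s` with `a ∈ 𝔭`, `s ∉ 𝔭`
  obtain ⟨a, s, rfl⟩ := IsLocalization.exists_mk'_eq 𝔭.primeCompl x
  have ha : a ∈ 𝔭 :=
    (IsLocalization.AtPrime.mk'_mem_maximal_iff (X.left.presheaf.stalk Q.pt) 𝔭 a s).1 hx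
  have ha' : a ∈ RingHom.ker (Q.evalRingHom ↑U hQU) := by rwa [hker]
  obtain ⟨coef, hcoef⟩ := htspan a ha'
  -- the value `c = s(Q) ≠ 0`
  set c : ℝ := Q.eval ↑U hQU s with hc
  have hc0 : c ≠ 0 := fun h0 => by
    have hs : (s : Γ(X.left, ↑U)) ∈ RingHom.ker (Q.evalRingHom ↑U hQU) := by
      rw [RingHom.mem_ker, AlgPoints.evalRingHom_apply]; exact h0
    rw [hker] at hs
    exact s.2 hs
  refine ⟨fun i => c⁻¹ * coef i, ?_⟩
  -- `1/s ≡ c⁻¹ (mod 𝔪)`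
  have hres : ∀ b : Γ(X.left, ↑U), IsLocalRing.residue _ (algebraMap Γ(X.left, ↑U) _ b) =
      IsLocalRing.residue (X.left.presheaf.stalk Q.pt)
        (algebraMap Γ(X.left, ↑U) _ (SchemeOver.scalarRingHom X ↑U (Q.eval ↑U hQU b))) := by
    intro b
    rw [← sub_eq_zero, ← map_sub, ← map_sub, IsLocalRing.residue_eq_zero_iff, hger,
      ← eval_eq_zero_iff_germ_mem_maximalIdeal, ← AlgPoints.evalRingHom_apply, map_sub,
      AlgPoints.evalRingHom_apply, AlgPoints.evalRingHom_apply, AlgPoints.eval_scalarRingHom,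
      sub_eq_zero]
    rfl
  have hdiff : IsLocalization.mk' (X.left.presheaf.stalk Q.pt) (1 : Γ(X.left, ↑U)) s -
      algebraMap Γ(X.left, ↑U) _ (SchemeOver.scalarRingHom X ↑U c⁻¹) ∈
        IsLocalRing.maximalIdeal (X.left.presheaf.stalk Q.pt) := by
    rw [← IsLocalRing.residue_eq_zero_iff, map_sub, sub_eq_zero]
    have hs1 : IsLocalization.mk' (X.left.presheaf.stalk Q.pt) (1 : Γ(X.left, ↑U)) s *
        algebraMap _ _ (s : Γ(X.left, ↑U)) = 1 := by
      rw [IsLocalization.mk'_spec, map_one]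
    have h1 := congrArg (IsLocalRing.residue (X.left.presheaf.stalk Q.pt)) hs1
    rw [map_mul, map_one, hres s] at h1
    have h2 : IsLocalRing.residue (X.left.presheaf.stalk Q.pt)
          (algebraMap Γ(X.left, ↑U) _ (SchemeOver.scalarRingHom X ↑U c)) *
        IsLocalRing.residue (X.left.presheaf.stalk Q.pt)
          (algebraMap Γ(X.left, ↑U) _ (SchemeOver.scalarRingHom X ↑U c⁻¹)) = 1 := by
      rw [← map_mul, ← map_mul, ← map_mul, mul_inv_cancel₀ hc0, map_one, map_one, map_one]
    have := congrArg (· * IsLocalRing.residue (X.left.presheaf.stalk Q.pt)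
      (algebraMap Γ(X.left, ↑U) _ (SchemeOver.scalarRingHom X ↑U c⁻¹))) h1
    simp only [one_mul, mul_assoc, ← hc, h2, mul_one] at this
    exact this
  have hgerm_a : algebraMap Γ(X.left, ↑U) (X.left.presheaf.stalk Q.pt) a ∈
      IsLocalRing.maximalIdeal _ :=
    (IsLocalization.AtPrime.to_map_mem_maximal_iff (X.left.presheaf.stalk Q.pt) 𝔭 a).2 ha
  -- decomposition
  have e1 : IsLocalization.mk' (X.left.presheaf.stalk Q.pt) a s -
      ∑ i, (X.left.presheaf.germ ↑U Q.pt hQU).hom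
        (SchemeOver.scalarRingHom X ↑U (c⁻¹ * coef i) * t i) =
      algebraMap _ _ a * (IsLocalization.mk' (X.left.presheaf.stalk Q.pt) (1 : Γ(X.left, ↑U)) s -
        algebraMap _ _ (SchemeOver.scalarRingHom X ↑U c⁻¹)) +
      algebraMap _ _ (SchemeOver.scalarRingHom X ↑U c⁻¹) *
        algebraMap Γ(X.left, ↑U) (X.left.presheaf.stalk Q.pt)
          (a - ∑ i, SchemeOver.scalarRingHom X ↑U (coef i) * t i) := by
    simp only [← hger, map_sub, map_sum, map_mul, mul_sub, Finset.mul_sum]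
    rw [IsLocalization.mk'_eq_mul_mk'_one]
    ring
  rw [e1, pow_two]
  refine Ideal.add_mem _ (Ideal.mul_mem_mul hgerm_a hdiff) (Ideal.mul_mem_left _ _ ?_)
  have : algebraMap Γ(X.left, ↑U) (X.left.presheaf.stalk Q.pt)
      (a - ∑ i, SchemeOver.scalarRingHom X ↑U (coef i) * t i) ∈
      Ideal.map (algebraMap Γ(X.left, ↑U) (X.left.presheaf.stalk Q.pt)) (𝔭 ^ 2) := by
    refine Ideal.mem_map_of_mem _ ?_
    rw [h𝔭, ← hker]; exact hcoef
  rw [Ideal.map_pow] at this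
  change _ ∈ Ideal.map (X.left.presheaf.germ ↑U Q.pt hQU).hom 𝔭 ^ 2 at this
  rwa [← hm, pow_two] at this

/-- Contraction: a section whose germ lies in `𝔪_Q²` lies in the square of the kernel of
evaluation at `Q` (the square of a maximal ideal is primary, and primary ideals are contracted
from the localisation). [folklore] -/
theorem mem_sq_ker_of_germ_mem_sq (Q : AlgPoints X ℝ) (U : X.left.affineOpens)
    (hQU : Q.pt ∈ (↑U : X.left.Opens)) {b : Γ(X.left, ↑U)}
    (hb : (X.left.presheaf.germ ↑U Q.pt hQU).hom b ∈
      IsLocalRing.maximalIdeal (X.left.presheaf.stalk Q.pt) ^ 2) :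
    b ∈ RingHom.ker (Q.evalRingHom ↑U hQU) ^ 2 := by
  letI alg : Algebra Γ(X.left, ↑U) (X.left.presheaf.stalk Q.pt) :=
    (X.left.presheaf.germ ↑U Q.pt hQU).hom.toAlgebra
  set 𝔭 := (U.2.primeIdealOf ⟨Q.pt, hQU⟩).asIdeal with h𝔭
  haveI : IsLocalization.AtPrime (X.left.presheaf.stalk Q.pt) 𝔭 :=
    U.2.isLocalization_stalk ⟨Q.pt, hQU⟩
  have hker := ker_evalRingHom_eq_primeIdealOf Q U hQU
  have h𝔭max : 𝔭.IsMaximal := by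
    rw [h𝔭, ← hker]; exact isMaximal_ker_evalRingHom Q hQU
  have hrad : (𝔭 ^ 2).radical = 𝔭 := by
    rw [Ideal.radical_pow 𝔭 two_ne_zero, h𝔭max.isPrime.radical]
  have hprim : (𝔭 ^ 2).IsPrimary := Ideal.isPrimary_of_isMaximal_radical (hrad.symm ▸ h𝔭max)
  have hdisj : Disjoint (𝔭.primeCompl : Set Γ(X.left, ↑U)) ↑(𝔭 ^ 2) := by
    rw [Set.disjoint_left]
    intro y hy hy2
    exact hy (Ideal.pow_le_self two_ne_zero hy2)
  have key := IsLocalization.under_map_of_isPrimary_disjoint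
    (S := X.left.presheaf.stalk Q.pt) 𝔭.primeCompl hprim hdisj
  rw [hker, ← key, Ideal.under, Ideal.mem_comap, Ideal.map_pow]
  have hm := maximalIdeal_eq_map_primeIdealOf U hQU
  change _ ∈ Ideal.map (X.left.presheaf.germ ↑U Q.pt hQU).hom 𝔭 ^ 2
  rwa [← hm]

/-- Restriction of the scalars is the scalars. [folklore] -/
theorem map_scalarRingHom {U W : X.left.Opens} (hle : W ≤ U) (c : ℝ) :
    X.left.presheaf.map (homOfLE hle).op (SchemeOver.scalarRingHom X U c) =
      SchemeOver.scalarRingHom X W c := by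
  rw [SchemeOver.scalarRingHom_apply, SchemeOver.scalarRingHom_apply]
  change (X.hom.appLE ⊤ U le_top ≫ X.left.presheaf.map (homOfLE hle).op) _ = _
  rw [Scheme.Hom.appLE_map]

/-- **Local coordinates restrict to local coordinates.** If `t` spans `ker (eval at Q) ⊆ Γ(X, U)`
modulo its square, then `t|_W` does so in `Γ(X, W)` for every affine `W ∋ Q`, `W ⊆ U` (both are
read in the local ring `𝒪_{X,Q}`). [folklore] -/
theorem htspan_of_le (Q : AlgPoints X ℝ) (U W : X.left.affineOpens)
    (hle : (↑W : X.left.Opens) ≤ ↑U) (hQU : Q.pt ∈ (↑U : X.left.Opens))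
    (hQW : Q.pt ∈ (↑W : X.left.Opens)) {m : ℕ} (t : Fin m → Γ(X.left, ↑U))
    (htspan : ∀ a ∈ RingHom.ker (Q.evalRingHom ↑U hQU), ∃ coef : Fin m → ℝ,
      a - ∑ i, SchemeOver.scalarRingHom X ↑U (coef i) * t i ∈
        RingHom.ker (Q.evalRingHom ↑U hQU) ^ 2) :
    ∀ a ∈ RingHom.ker (Q.evalRingHom ↑W hQW), ∃ coef : Fin m → ℝ,
      a - ∑ i, SchemeOver.scalarRingHom X ↑W (coef i) *
        X.left.presheaf.map (homOfLE hle).op (t i) ∈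
        RingHom.ker (Q.evalRingHom ↑W hQW) ^ 2 := by
  intro a ha
  have hx : (X.left.presheaf.germ ↑W Q.pt hQW).hom a ∈
      IsLocalRing.maximalIdeal (X.left.presheaf.stalk Q.pt) := by
    rw [← eval_eq_zero_iff_germ_mem_maximalIdeal]
    rwa [RingHom.mem_ker, AlgPoints.evalRingHom_apply] at ha
  obtain ⟨coef, hcoef⟩ := exists_sub_sum_germ_mem_sq Q U hQU t htspan hx
  refine ⟨coef, mem_sq_ker_of_germ_mem_sq Q W hQW ?_⟩
  have : (X.left.presheaf.germ ↑W Q.pt hQW).hom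
      (a - ∑ i, SchemeOver.scalarRingHom X ↑W (coef i) *
        X.left.presheaf.map (homOfLE hle).op (t i)) =
      (X.left.presheaf.germ ↑W Q.pt hQW).hom a -
        ∑ i, (X.left.presheaf.germ ↑U Q.pt hQU).hom
          (SchemeOver.scalarRingHom X ↑U (coef i) * t i) := by
    simp only [map_sub, map_sum, ← map_scalarRingHom hle, ← map_mul]
    congr 1
    refine Finset.sum_congr rfl fun i _ => ?_
    exact TopCat.Presheaf.germ_res_apply X.left.presheaf (homOfLE hle) Q.pt hQW _
  rw [this]
  exact hcoef

/-- **A system of parameters of `𝒪_{X,Q}` is represented by local coordinates.** If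
`u₁, …, uₘ` generate the maximal ideal of the local ring at the real point `Q`, then on every
affine open `U ∋ Q` there are sections `tᵢ` whose germs are associates of the `uᵢ` (so generate the
maximal ideal, the `i`-th the same principal ideal as `uᵢ`), vanishing at `Q` and spanning
`ker (eval at Q)` modulo its square. [folklore] -/
theorem exists_sections_of_span_eq_maximalIdeal (Q : AlgPoints X ℝ) {m : ℕ}
    (u : Fin m → X.left.presheaf.stalk Q.pt)
    (hu : Ideal.span (Set.range u) = IsLocalRing.maximalIdeal (X.left.presheaf.stalk Q.pt))
    (U : X.left.affineOpens) (hQU : Q.pt ∈ (↑U : X.left.Opens)) :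
    ∃ t : Fin m → Γ(X.left, ↑U),
      (∀ i, Associated (u i) ((X.left.presheaf.germ ↑U Q.pt hQU).hom (t i))) ∧
      Ideal.span (Set.range fun i => (X.left.presheaf.germ ↑U Q.pt hQU).hom (t i)) =
        IsLocalRing.maximalIdeal (X.left.presheaf.stalk Q.pt) ∧
      (∀ i, t i ∈ RingHom.ker (Q.evalRingHom ↑U hQU)) ∧
      ∀ a ∈ RingHom.ker (Q.evalRingHom ↑U hQU), ∃ coef : Fin m → ℝ,
        a - ∑ i, SchemeOver.scalarRingHom X ↑U (coef i) * t i ∈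
          RingHom.ker (Q.evalRingHom ↑U hQU) ^ 2 := by
  classical
  letI alg : Algebra Γ(X.left, ↑U) (X.left.presheaf.stalk Q.pt) :=
    (X.left.presheaf.germ ↑U Q.pt hQU).hom.toAlgebra
  set 𝔭 := (U.2.primeIdealOf ⟨Q.pt, hQU⟩).asIdeal with h𝔭
  haveI : IsLocalization.AtPrime (X.left.presheaf.stalk Q.pt) 𝔭 :=
    U.2.isLocalization_stalk ⟨Q.pt, hQU⟩
  -- representatives up to units
  have hrep : ∀ i, ∃ s : Γ(X.left, ↑U),
      Associated (u i) ((X.left.presheaf.germ ↑U Q.pt hQU).hom s) := by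
    intro i
    obtain ⟨⟨s, g⟩, hsg⟩ := IsLocalization.surj 𝔭.primeCompl (u i)
    refine ⟨s, ?_⟩
    have hg : IsUnit (algebraMap Γ(X.left, ↑U) (X.left.presheaf.stalk Q.pt) g) :=
      IsLocalization.map_units _ g
    exact ⟨hg.unit, by rw [IsUnit.unit_spec]; exact hsg⟩
  choose t ht using hrep
  have hspan : Ideal.span (Set.range fun i => (X.left.presheaf.germ ↑U Q.pt hQU).hom (t i)) =
      IsLocalRing.maximalIdeal (X.left.presheaf.stalk Q.pt) := by
    rw [← hu]
    refine le_antisymm (Ideal.span_le.2 ?_) (Ideal.span_le.2 ?_)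
    · rintro _ ⟨i, rfl⟩
      obtain ⟨w, hw⟩ := ht i
      change (X.left.presheaf.germ ↑U Q.pt hQU).hom (t i) ∈ Ideal.span (Set.range u)
      rw [← hw]
      exact Ideal.mul_mem_right _ _ (Ideal.subset_span ⟨i, rfl⟩)
    · rintro _ ⟨i, rfl⟩
      obtain ⟨w, hw⟩ := ht i
      have : u i = (X.left.presheaf.germ ↑U Q.pt hQU).hom (t i) * ↑w⁻¹ := by
        rw [← hw, mul_assoc, Units.mul_inv, mul_one]
      change u i ∈ Ideal.span (Set.range fun i => (X.left.presheaf.germ ↑U Q.pt hQU).hom (t i))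
      rw [this]
      exact Ideal.mul_mem_right _ _ (Ideal.subset_span ⟨i, rfl⟩)
  have ht0 : ∀ i, t i ∈ RingHom.ker (Q.evalRingHom ↑U hQU) := fun i => by
    rw [RingHom.mem_ker, AlgPoints.evalRingHom_apply, eval_eq_zero_iff_germ_mem_maximalIdeal,
      ← hspan]
    exact Ideal.subset_span ⟨i, rfl⟩
  refine ⟨t, ht, hspan, ht0, fun a ha => ?_⟩
  -- `germ a = ∑ gᵢ germ(tᵢ)`; reduce the coefficients to their values
  have hga : (X.left.presheaf.germ ↑U Q.pt hQU).hom a ∈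
      Ideal.span (Set.range fun i => (X.left.presheaf.germ ↑U Q.pt hQU).hom (t i)) := by
    rw [hspan, ← eval_eq_zero_iff_germ_mem_maximalIdeal]
    rwa [RingHom.mem_ker, AlgPoints.evalRingHom_apply] at ha
  obtain ⟨g, hg⟩ := Ideal.mem_span_range_iff_exists_fun.1 hga
  -- values of stalk elements at `Q`
  let ev : X.left.presheaf.stalk Q.pt → ℝ := fun y => Q.resHom (IsLocalRing.residue _ y)
  have hev_germ : ∀ b : Γ(X.left, ↑U),
      ev ((X.left.presheaf.germ ↑U Q.pt hQU).hom b) = Q.eval ↑U hQU b :=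
    fun b => rfl
  have hmem : ∀ y : X.left.presheaf.stalk Q.pt,
      y - (X.left.presheaf.germ ↑U Q.pt hQU).hom (SchemeOver.scalarRingHom X ↑U (ev y)) ∈
        IsLocalRing.maximalIdeal _ := by
    intro y
    rw [← IsLocalRing.residue_eq_zero_iff, map_sub, sub_eq_zero]
    apply Q.resHom.hom.injective
    change ev y = ev ((X.left.presheaf.germ ↑U Q.pt hQU).hom (SchemeOver.scalarRingHom X ↑U (ev y)))
    rw [hev_germ, AlgPoints.eval_scalarRingHom]
    rfl
  refine ⟨fun i => ev (g i), mem_sq_ker_of_germ_mem_sq Q U hQU ?_⟩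
  have e1 : (X.left.presheaf.germ ↑U Q.pt hQU).hom
      (a - ∑ i, SchemeOver.scalarRingHom X ↑U (ev (g i)) * t i) =
      ∑ i, (g i - (X.left.presheaf.germ ↑U Q.pt hQU).hom
        (SchemeOver.scalarRingHom X ↑U (ev (g i)))) *
        (X.left.presheaf.germ ↑U Q.pt hQU).hom (t i) := by
    simp only [map_sub, map_sum, map_mul, ← hg, ← Finset.sum_sub_distrib, sub_mul]
  rw [e1, pow_two]
  refine Ideal.sum_mem _ fun i _ => Ideal.mul_mem_mul (hmem (g i)) ?_
  rw [← hspan]; exact Ideal.subset_span ⟨i, rfl⟩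

end Germs

/-! ### The `ℝ`-algebra of sections and evaluation as an algebra homomorphism -/

section SectionsAlgebra

variable {X : SchemeOver ℝ}

-- the `ℝ`-algebra structure of `Γ(X, U)` by the scalars `SchemeOver.scalarRingHom X U` (the
-- tree's reducible `UniversalHyperplaneSection.sectionsAlgebra`, a file-local instance as there)
attribute [local instance] UniversalHyperplaneSection.sectionsAlgebra

/-- Restriction to a basic open is compatible with the scalars. [folklore] -/
theorem isScalarTower_basicOpen (U : X.left.Opens) (r : Γ(X.left, U)) :
    IsScalarTower ℝ Γ(X.left, U) Γ(X.left, X.left.basicOpen r) :=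
  IsScalarTower.of_algebraMap_eq' (by
    refine RingHom.ext fun c => ?_
    rw [RingHom.comp_apply, UniversalHyperplaneSection.algebraMap_sections,
      UniversalHyperplaneSection.algebraMap_sections]
    exact (map_scalarRingHom (X.left.basicOpen_le r) c).symm)

/-- Evaluation at a real point of `U` as an `ℝ`-algebra homomorphism `Γ(X, U) → ℝ`. [folklore] -/
def evalAlgHom (Q : AlgPoints X ℝ) (U : X.left.Opens) (hQU : Q.pt ∈ U) : Γ(X.left, U) →ₐ[ℝ] ℝ :=
  { Q.evalRingHom U hQU with commutes' := fun c => AlgPoints.eval_scalarRingHom Q hQU c }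

/-- Unfolding `evalAlgHom`. [folklore] -/
@[simp] theorem evalAlgHom_apply (Q : AlgPoints X ℝ) (U : X.left.Opens) (hQU : Q.pt ∈ U)
    (a : Γ(X.left, U)) : evalAlgHom Q U hQU a = Q.eval U hQU a := rfl

/-- Standard smoothness of relative dimension `d` over the scalars passes to basic opens (it is
preserved by localisation). [folklore] -/
theorem isStandardSmoothOfRelativeDimension_basicOpen {V : X.left.Opens} (hV : IsAffineOpen V)
    {d : ℕ} (hsm : RingHom.IsStandardSmoothOfRelativeDimension d (SchemeOver.scalarRingHom X V))
    (g : Γ(X.left, V)) :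
    RingHom.IsStandardSmoothOfRelativeDimension d
      (SchemeOver.scalarRingHom X (X.left.basicOpen g)) := by
  haveI : IsLocalization.Away g Γ(X.left, X.left.basicOpen g) := hV.isLocalization_basicOpen g
  have h0 : (algebraMap Γ(X.left, V)
      Γ(X.left, X.left.basicOpen g)).IsStandardSmoothOfRelativeDimension 0 :=
    RingHom.IsStandardSmoothOfRelativeDimension.algebraMap_isLocalizationAway g
  have hcomp : (algebraMap Γ(X.left, V) Γ(X.left, X.left.basicOpen g)).comp
      (SchemeOver.scalarRingHom X V) = SchemeOver.scalarRingHom X (X.left.basicOpen g) :=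
    RingHom.ext fun c => map_scalarRingHom (X.left.basicOpen_le g) c
  have := RingHom.IsStandardSmoothOfRelativeDimension.comp h0 hsm
  rw [hcomp, Nat.zero_add] at this
  exact this

end SectionsAlgebra

attribute [local instance] UniversalHyperplaneSection.sectionsAlgebra

/-! ### The analytic differential at a real point is a point derivation; comparison with `Ω` -/

section PointDerivation

variable {X : SchemeOver ℝ} {n : ℕ}
variable (e : OpenPartialHomeomorph (AlgPoints X ℝ) (Fin n → ℝ)) {Q : AlgPoints X ℝ}
  (hQ : Q ∈ e.source)
  (hol : ∀ (U : X.left.affineOpens) (s : Γ(X.left, ↑U)),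
    AnalyticOnNhd ℝ (evalOrZero ↑U s ∘ e.symm)
      (e.target ∩ e.symm ⁻¹' {P | P.pt ∈ (↑U : X.left.Opens)}))

/-- **The analytic differential at a real point is a point derivation.** For an analytic algebraic
chart `e` at `Q`, an affine `U ∋ Q` and a vector `v ∈ ℝⁿ`, the map
`a ↦ d(a ∘ e⁻¹)(e Q) · v` is an `ℝ`-derivation of `Γ(X, U)` into `ℝ_Q` (the `Γ(X, U)`-module `ℝ`
through evaluation at `Q`, the tree's `Literature.PointModule`): the tangent vector `v` at `Q`.
[cite: SerreGAGA1956, §2 n°6] -/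
def fderivPointDerivation (U : X.left.affineOpens) (hU : Q.pt ∈ (↑U : X.left.Opens))
    (v : Fin n → ℝ) : Derivation ℝ Γ(X.left, ↑U) (PointModule (evalAlgHom Q ↑U hU)) :=
  have _h1 := hQ
  have _h2 := hol
  {
  toFun := fun a => (fderiv ℝ (evalOrZero ↑U a ∘ e.symm) (e Q) v : ℝ)
  map_add' := fun a b => by
    change fderiv ℝ (evalOrZero ↑U (a + b) ∘ e.symm) (e Q) v =
      fderiv ℝ (evalOrZero ↑U a ∘ e.symm) (e Q) v + fderiv ℝ (evalOrZero ↑U b ∘ e.symm) (e Q) v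
    rw [fderiv_chart_add e hQ hol U hU, add_apply]
  map_smul' := fun c a => by
    change fderiv ℝ (evalOrZero ↑U (c • a) ∘ e.symm) (e Q) v =
      c • fderiv ℝ (evalOrZero ↑U a ∘ e.symm) (e Q) v
    rw [Algebra.smul_def, UniversalHyperplaneSection.algebraMap_sections,
      fderiv_chart_smul e hQ hol U hU, smul_apply]
  map_one_eq_zero' := by
    change fderiv ℝ (evalOrZero ↑U 1 ∘ e.symm) (e Q) v = 0
    rw [← map_one (SchemeOver.scalarRingHom X ↑U), fderiv_chart_scalarRingHom e hQ U hU, zero_apply]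
  leibniz' := fun a b => by
    change fderiv ℝ (evalOrZero ↑U (a * b) ∘ e.symm) (e Q) v =
      (evalAlgHom Q ↑U hU a • fderiv ℝ (evalOrZero ↑U b ∘ e.symm) (e Q) v : ℝ) +
        (evalAlgHom Q ↑U hU b • fderiv ℝ (evalOrZero ↑U a ∘ e.symm) (e Q) v : ℝ)
    rw [fderiv_chart_mul e hQ hol U hU, add_apply, smul_apply, smul_apply, evalAlgHom_apply,
      evalAlgHom_apply] }

/-- Unfolding `fderivPointDerivation`. [folklore] -/
theorem fderivPointDerivation_apply (U : X.left.affineOpens) (hU : Q.pt ∈ (↑U : X.left.Opens))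
    (v : Fin n → ℝ) (a : Γ(X.left, ↑U)) :
    (fderivPointDerivation e hQ hol U hU v a : ℝ) = fderiv ℝ (evalOrZero ↑U a ∘ e.symm) (e Q) v :=
  rfl

include hQ hol in
/-- **Analytic partial derivatives are the values of the algebraic ones.** If `(dtⱼ)ⱼ` is a basis
of `Ω_{Γ(X,U)/ℝ}`, then for every `a ∈ Γ(X, U)` and every real point `Q ∈ U(ℝ)` in the source of
an analytic algebraic chart `e`,
`d(a ∘ e⁻¹)(e Q) · v = ∑ⱼ (∂a/∂tⱼ)(Q) · d(tⱼ ∘ e⁻¹)(e Q) · v`, where `∂a/∂tⱼ ∈ Γ(X, U)` is the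
`j`-th coordinate of `da` in the basis (the point derivation `d(· ∘ e⁻¹)(e Q) · v` factors through
`Ω`). [cite: SerreGAGA1956, §2 n°6 Prop. 3] -/
theorem fderiv_chart_apply_eq_sum {m : ℕ} (U : X.left.affineOpens) (hU : Q.pt ∈ (↑U : X.left.Opens))
    (b : Module.Basis (Fin m) Γ(X.left, ↑U) Ω[Γ(X.left, ↑U)⁄ℝ]) (t : Fin m → Γ(X.left, ↑U))
    (hb : ∀ j, b j = D ℝ Γ(X.left, ↑U) (t j)) (a : Γ(X.left, ↑U)) (v : Fin n → ℝ) :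
    fderiv ℝ (evalOrZero ↑U a ∘ e.symm) (e Q) v =
      ∑ j, Q.eval ↑U hU (b.repr (D ℝ Γ(X.left, ↑U) a) j) *
        fderiv ℝ (evalOrZero ↑U (t j) ∘ e.symm) (e Q) v := by
  set δ := fderivPointDerivation e hQ hol U hU v with hδ
  set τ := PointModule.toK (evalAlgHom Q ↑U hU) with hτ
  calc fderiv ℝ (evalOrZero ↑U a ∘ e.symm) (e Q) v = τ (δ a) := rfl
    _ = τ (δ.liftKaehlerDifferential (D ℝ Γ(X.left, ↑U) a)) := by
      rw [δ.liftKaehlerDifferential_comp_D a]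
    _ = τ (δ.liftKaehlerDifferential (∑ j, b.repr (D ℝ Γ(X.left, ↑U) a) j • b j)) := by
      rw [b.sum_repr]
    _ = ∑ j, τ (b.repr (D ℝ Γ(X.left, ↑U) a) j • δ.liftKaehlerDifferential (b j)) := by
      rw [map_sum, map_sum]
      simp only [map_smul]
    _ = ∑ j, Q.eval ↑U hU (b.repr (D ℝ Γ(X.left, ↑U) a) j) *
        fderiv ℝ (evalOrZero ↑U (t j) ∘ e.symm) (e Q) v := by
      refine Finset.sum_congr rfl fun j _ => ?_
      rw [hb, Derivation.liftKaehlerDifferential_comp_D, PointModule.smul_def, evalAlgHom_apply,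
        map_smul, smul_eq_mul]
      rfl

include hQ hol in
/-- `fderiv_chart_apply_eq_sum` as an identity of differentials:
`d(a ∘ e⁻¹)(e Q) = ∑ⱼ (∂a/∂tⱼ)(Q) d(tⱼ ∘ e⁻¹)(e Q)`. [cite: SerreGAGA1956, §2 n°6 Prop. 3] -/
theorem fderiv_chart_eq_sum {m : ℕ} (U : X.left.affineOpens) (hU : Q.pt ∈ (↑U : X.left.Opens))
    (b : Module.Basis (Fin m) Γ(X.left, ↑U) Ω[Γ(X.left, ↑U)⁄ℝ]) (t : Fin m → Γ(X.left, ↑U))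
    (hb : ∀ j, b j = D ℝ Γ(X.left, ↑U) (t j)) (a : Γ(X.left, ↑U)) :
    fderiv ℝ (evalOrZero ↑U a ∘ e.symm) (e Q) =
      ∑ j, Q.eval ↑U hU (b.repr (D ℝ Γ(X.left, ↑U) a) j) •
        fderiv ℝ (evalOrZero ↑U (t j) ∘ e.symm) (e Q) := by
  ext v
  rw [fderiv_chart_apply_eq_sum e hQ hol U hU b t hb a v, FunLike.coe_sum, Finset.sum_apply]
  simp only [FunLike.coe_smul, Pi.smul_apply, smul_eq_mul]

end PointDerivation

/-! ### Local coordinates give a basis of `Ω` on an affine neighbourhood -/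

section Basis

variable {X : SchemeOver ℝ} {n : ℕ}

/-- **A system of local coordinates at a smooth real point is a local frame of `Ω`.** Let `X` be
smooth of relative dimension `n` over `ℝ`, `Q₀ ∈ U(ℝ)`, `U` affine, and `t₁, …, tₙ ∈ Γ(X, U)` span
`ker (eval at Q₀)` modulo its square. Then `Q₀` has an affine open neighbourhood `W ⊆ U`, inside
any prescribed open `O`, over which `dt₁|_W, …, dtₙ|_W` is a basis of `Ω_{Γ(X,W)/ℝ}`: on a standard
smooth affine neighbourhood `Ω` is free of rank `n`; by Nakayama the `dtⱼ` generate `Ω` after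
inverting some `r` with `r(Q₀) = 1`; `n` generators of a free module of rank `n` form a basis.
[cite: GortzWedhorn2020, Lemma 6.26 and Thm. 6.28] [cite: StacksProject, Tag 00TV] -/
theorem exists_affineOpen_basis_kaehler [SmoothOfRelativeDimension n X.hom]
    (U : X.left.affineOpens) {Q₀ : AlgPoints X ℝ} (hU : Q₀.pt ∈ (↑U : X.left.Opens))
    (t : Fin n → Γ(X.left, ↑U))
    (htspan : ∀ a ∈ RingHom.ker (Q₀.evalRingHom ↑U hU), ∃ coef : Fin n → ℝ,
      a - ∑ i, SchemeOver.scalarRingHom X ↑U (coef i) * t i ∈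
        RingHom.ker (Q₀.evalRingHom ↑U hU) ^ 2)
    (O : X.left.Opens) (hO : Q₀.pt ∈ O) :
    ∃ (W : X.left.affineOpens) (_ : Q₀.pt ∈ (↑W : X.left.Opens))
      (hle : (↑W : X.left.Opens) ≤ ↑U), (↑W : X.left.Opens) ≤ O ∧
      ∃ b : Module.Basis (Fin n) Γ(X.left, ↑W) Ω[Γ(X.left, ↑W)⁄ℝ],
        ∀ j, b j = D ℝ Γ(X.left, ↑W) (X.left.presheaf.map (homOfLE hle).op (t j)) := by
  classical
  obtain ⟨V, hV, hQ₀V, hsmV⟩ :=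
    AlgPoints.exists_isStandardSmoothOfRelativeDimension_scalarRingHom n Q₀
  obtain ⟨g, hgle, hQ₀g⟩ :=
    hV.exists_basicOpen_le ⟨Q₀.pt, (show Q₀.pt ∈ ((↑U : X.left.Opens) ⊓ O) from ⟨hU, hO⟩)⟩ hQ₀V
  -- `W₁ = D(g) ⊆ U ∩ O`, standard smooth over `ℝ`
  have hW₁ : IsAffineOpen (X.left.basicOpen g) := hV.basicOpen g
  have hW₁U : X.left.basicOpen g ≤ ↑U := fun x hx => (hgle hx).1
  have hW₁O : X.left.basicOpen g ≤ O := fun x hx => (hgle hx).2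
  have hsm₁ := isStandardSmoothOfRelativeDimension_basicOpen hV hsmV g
  have htspan₁ := htspan_of_le Q₀ U ⟨X.left.basicOpen g, hW₁⟩ hW₁U hU hQ₀g t htspan
  haveI i1 : Algebra.IsStandardSmoothOfRelativeDimension n ℝ Γ(X.left, X.left.basicOpen g) := hsm₁
  haveI i2 : Algebra.IsStandardSmooth ℝ Γ(X.left, X.left.basicOpen g) :=
    Algebra.IsStandardSmoothOfRelativeDimension.isStandardSmooth n
  haveI i3 : Algebra.FiniteType ℝ Γ(X.left, X.left.basicOpen g) := inferInstance
  haveI i4 : Algebra.EssFiniteType ℝ Γ(X.left, X.left.basicOpen g) := inferInstance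
  -- Nakayama
  set t₁ : Fin n → Γ(X.left, X.left.basicOpen g) := fun i =>
    X.left.presheaf.map (homOfLE hW₁U).op (t i) with ht₁
  have hψ : ∀ a, evalAlgHom Q₀ (X.left.basicOpen g) hQ₀g a = 0 ↔
      a ∈ RingHom.ker (Q₀.evalRingHom (X.left.basicOpen g) hQ₀g) := fun a => by
    rw [RingHom.mem_ker]; rfl
  have htspan₁' : ∀ a ∈ RingHom.ker (Q₀.evalRingHom (X.left.basicOpen g) hQ₀g),
      ∃ coef : Fin n → ℝ, a - ∑ i, coef i • t₁ i ∈
        RingHom.ker (Q₀.evalRingHom (X.left.basicOpen g) hQ₀g) ^ 2 := by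
    intro a ha
    obtain ⟨coef, hcoef⟩ := htspan₁ a ha
    refine ⟨coef, ?_⟩
    simp only [Algebra.smul_def, UniversalHyperplaneSection.algebraMap_sections, ht₁]
    exact hcoef
  obtain ⟨r, hr1, hr⟩ := exists_smul_mem_span_D
    (RingHom.ker (Q₀.evalRingHom (X.left.basicOpen g) hQ₀g))
    (evalAlgHom Q₀ (X.left.basicOpen g) hQ₀g) hψ t₁ htspan₁'
  -- `W = D(r)`
  have hW : IsAffineOpen (X.left.basicOpen r) := hW₁.basicOpen r
  have hr0 : Q₀.eval (X.left.basicOpen g) hQ₀g r = 1 := by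
    rw [RingHom.mem_ker, map_sub, map_one, sub_eq_zero, AlgPoints.evalRingHom_apply] at hr1
    exact hr1
  have hQ₀W : Q₀.pt ∈ X.left.basicOpen r := by
    rw [AlgPoints.pt_mem_basicOpen_iff Q₀ hQ₀g, hr0]; exact one_ne_zero
  have hWW₁ : X.left.basicOpen r ≤ X.left.basicOpen g := X.left.basicOpen_le r
  haveI : IsLocalization.Away r Γ(X.left, X.left.basicOpen r) := hW₁.isLocalization_basicOpen r
  haveI : IsScalarTower ℝ Γ(X.left, X.left.basicOpen g) Γ(X.left, X.left.basicOpen r) :=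
    isScalarTower_basicOpen _ r
  have hgen := top_le_span_D_of_isLocalization (K := ℝ) (B := Γ(X.left, X.left.basicOpen r)) r t₁ hr
  -- `Ω` over `W` is free of rank `n`
  have hsmW := isStandardSmoothOfRelativeDimension_basicOpen hW₁ hsm₁ r
  haveI j1 : Algebra.IsStandardSmoothOfRelativeDimension n ℝ Γ(X.left, X.left.basicOpen r) := hsmW
  haveI j2 : Algebra.IsStandardSmooth ℝ Γ(X.left, X.left.basicOpen r) :=
    Algebra.IsStandardSmoothOfRelativeDimension.isStandardSmooth n
  haveI j3 : Algebra.FiniteType ℝ Γ(X.left, X.left.basicOpen r) := inferInstance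
  haveI j4 : Algebra.EssFiniteType ℝ Γ(X.left, X.left.basicOpen r) := inferInstance
  haveI : Nontrivial Γ(X.left, X.left.basicOpen r) :=
    (Q₀.evalRingHom (X.left.basicOpen r) hQ₀W).domain_nontrivial
  have hrank :
      Module.finrank Γ(X.left, X.left.basicOpen r) Ω[Γ(X.left, X.left.basicOpen r)⁄ℝ] = n :=
    Module.finrank_eq_of_rank_eq
      (Algebra.IsStandardSmoothOfRelativeDimension.rank_kaehlerDifferential n)
  set b := basisOfTopLeSpanOfCardEqFinrank _ hgen (by simp [hrank]) with hbdef
  refine ⟨⟨X.left.basicOpen r, hW⟩, hQ₀W, hWW₁.trans hW₁U, hWW₁.trans hW₁O, b, fun j => ?_⟩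
  rw [hbdef, coe_basisOfTopLeSpanOfCardEqFinrank]
  congr 1
  change (X.left.presheaf.map (homOfLE hW₁U).op ≫ X.left.presheaf.map (homOfLE hWW₁).op) (t j) = _
  rw [← Functor.map_comp]
  rfl

end Basis

end RealPoints

end Literature.AlgebraicGeometry.RealAlgebraic

end
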